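import Summits.BirchSwinnertonDyer.BirchSwinnertonDyer.Theorems.Rank2Observatory2DescClIndexCert
import HarnessLib

/-!
# BirchSwinnertonDyer — rank ≥ 2 observatory: KERNEL-2DESC-CL generic layer — NORMALISED local index certificate

HONEST FRAMING: per-curve certified theorems and census instruments; no claim on BSD in rank ≥ 2.

`Rank2Observatory2DescClIndexCert` certifies `𝓞 K = ℤ[θ]` for a cubic field `K = ℚ(θ)`, `g(θ) = 0`,
`g = X³ + aX² + bX + c`, from LOCAL certificates: for each prime `p` with `p² ∣ Δ(g)`, no `(x + yθ + zθ²)/p` with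
`(x, y, z) ∈ [0, p)³ ∖ 0` is an algebraic integer (trace / norm / shifted-norm battery `localCertOK`, `p³ − 1` triples,
evaluated by `decide` in the kernel).  This file proves the **projective reduction**: integrality of `W/p` is invariant
under multiplying the residue triple by a unit of `ℤ/p` (the difference is `p`·(an element of `ℤ[θ]`)), so it suffices
to run the battery on the `p² + p + 1` NORMALISED triples `(x, y, 1)`, `(x, 1, 0)`, `(1, 0, 0)` — `localCertOKNorm`.
For the observatory this turns the certificate at `p = 229` (`229³ − 1 ≈ 1.2·10⁷` triples, infeasible in the kernel) into
`52 671` triples, and speeds every non-squarefree field.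

* `TwoDescCl.exists_scaled_rep` — if `p·w = x + yθ + zθ²` (`w ∈ 𝓞 K`) then for every `l : ℕ` some `w' ∈ 𝓞 K` has
  `p·w' = (lx mod p) + (ly mod p)θ + (lz mod p)θ²`;
* `TwoDescCl.localTest`, `localTest_sound` — the three-test battery at one triple;
* `TwoDescCl.localCertOKNorm`, `localCertNorm_sound` — the normalised Boolean certificate and its soundness for ALL
  `(x, y, z) ∈ [0, p)³ ∖ 0`;
* `TwoDescCl.exponent_thetaInt_of_localCertsNorm` — `𝓞 K = ℤ[θ]` from `|Δ(g)| = ∏ Pᵢ^{eᵢ}` and, per `Pᵢ`, either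
  `Pᵢ² ∤ Δ(g)` or `localCertOKNorm a b c Pᵢ = true` (the form the per-field files use).

The battery is complete as well as sound (`W/p ∈ 𝓞 K ⟺ p ∣ Tr W ∧ p² ∣ s₂(W) ∧ p³ ∣ N(W)`, and given the first and last,
`p³ ∣ N(W + p) ⟺ p² ∣ s₂(W)`), so `localCertOKNorm a b c p = true ⟺ p ∤ [𝓞 K : ℤ[θ]]`; only soundness is needed here.

Sorry-free; axioms `propext`, `Classical.choice`, `Quot.sound`.
[cite: Marcus2018, Ch. 2, Thm. 4, Thm. 13 and Exercise 27; Ch. 3, Thm. 27] [cite: Cohen1993, §4.8.2, §6.1]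
-/

-- single-conjunct summit: `Summit.BirchSwinnertonDyer.BirchSwinnertonDyer.…` repeats the name by design
set_option linter.dupNamespace false

noncomputable section

open scoped NumberField
open Module NumberField Polynomial

namespace Summit.BirchSwinnertonDyer.BirchSwinnertonDyer.Rank2Observatory.TwoDescCl

open Literature.NumberTheory.NumberFields

variable {K : Type*} [Field K] [NumberField K]
variable {a b c : ℤ} {θ : K}

/-- Casting `m mod k` into a ring: `↑(m % k) = ↑m − ↑k·↑(m / k)`. [folklore] -/
theorem natCast_mod_eq_sub {R : Type*} [Ring R] (m k : ℕ) :
    ((m % k : ℕ) : R) = (m : R) - (k : R) * ((m / k : ℕ) : R) := by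
  rw [eq_sub_iff_add_eq, ← Nat.cast_mul, ← Nat.cast_add, Nat.mod_add_div]

omit [NumberField K] in
/-- **Projective reduction.** If `p·w = x + yθ + zθ²` with `w ∈ 𝓞 K` (`θ` a root of the monic integer cubic `g`), then for
every `l : ℕ` the triple `(lx mod p, ly mod p, lz mod p)` is also represented: `p·w' = …` with
`w' = l·w − (⌊lx/p⌋ + ⌊ly/p⌋θ + ⌊lz/p⌋θ²) ∈ 𝓞 K`. [cite: Marcus2018, Ch. 2, Exercise 27] -/
theorem exists_scaled_rep (hθ : aeval θ (MonicCubic.poly a b c) = 0) (p x y z : ℕ) (w : 𝓞 K)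
    (hw : (p : K) * w = (x : K) + (y : K) * θ + (z : K) * θ ^ 2) (l : ℕ) :
    ∃ w' : 𝓞 K, (p : K) * w' =
      ((l * x % p : ℕ) : K) + ((l * y % p : ℕ) : K) * θ + ((l * z % p : ℕ) : K) * θ ^ 2 := by
  refine ⟨(l : 𝓞 K) * w - (((l * x / p : ℕ) : 𝓞 K) + ((l * y / p : ℕ) : 𝓞 K) * MonicCubic.thetaInt hθ +
    ((l * z / p : ℕ) : 𝓞 K) * MonicCubic.thetaInt hθ ^ 2), ?_⟩
  have e : (((l : 𝓞 K) * w - (((l * x / p : ℕ) : 𝓞 K) + ((l * y / p : ℕ) : 𝓞 K) * MonicCubic.thetaInt hθ +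
      ((l * z / p : ℕ) : 𝓞 K) * MonicCubic.thetaInt hθ ^ 2) : 𝓞 K) : K) =
      (l : K) * (w : K) - (((l * x / p : ℕ) : K) + ((l * y / p : ℕ) : K) * θ + ((l * z / p : ℕ) : K) * θ ^ 2) := by
    simp [MonicCubic.coe_thetaInt]
  rw [e, natCast_mod_eq_sub (l * x) p, natCast_mod_eq_sub (l * y) p, natCast_mod_eq_sub (l * z) p]
  push_cast
  linear_combination (l : K) * hw

/-- The three-test battery at one triple `(x, y, z)`: `p ∤ Tr W`, or `p³ ∤ N(W)`, or `p³ ∤ N(W + p)`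
(`W = x + yθ + zθ²`). [cite: Marcus2018, Ch. 2, Thm. 13 and Exercise 27] -/
def localTest (a b c : ℤ) (p x y z : ℕ) : Bool :=
  !decide ((p : ℤ) ∣ traceZ a b x y z) || !decide ((p : ℤ) ^ 3 ∣ normFormZ a b c x y z) ||
    !decide ((p : ℤ) ^ 3 ∣ normFormZ a b c ((x + p : ℕ) : ℤ) y z)

/-- Soundness of the battery at one triple: `(x + yθ + zθ²)/p ∉ 𝓞 K`. [cite: Marcus2018, Ch. 2, Thm. 4] -/
theorem localTest_sound (hirr : Irreducible (MonicCubic.polyQ a b c)) (hθ : aeval θ (MonicCubic.poly a b c) = 0)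
    (h3 : finrank ℚ K = 3) (p x y z : ℕ) (ht : localTest a b c p x y z = true) (w : 𝓞 K) :
    (p : K) * w ≠ (x : K) + (y : K) * θ + (z : K) * θ ^ 2 := by
  simp only [localTest, Bool.or_eq_true, Bool.not_eq_true', decide_eq_false_iff_not] at ht
  rcases ht with (hT | hN) | hS
  · exact ne_of_trace hirr hθ h3 p x y z hT w
  · exact ne_of_norm hirr hθ h3 p x y z hN w
  · exact ne_of_norm_shift hirr hθ h3 p x y z hS w

/-- The NORMALISED local certificate at `p`: the battery on the `p² + p + 1` triples `(1, 0, 0)`, `(x, 1, 0)`,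
`(x, y, 1)` (`x, y ∈ [0, p)`). [cite: Marcus2018, Ch. 2, Thm. 13 and Exercise 27] -/
def localCertOKNorm (a b c : ℤ) (p : ℕ) : Bool :=
  localTest a b c p 1 0 0 && (List.range p).all (fun x => localTest a b c p x 1 0) &&
    (List.range p).all fun x => (List.range p).all fun y => localTest a b c p x y 1

/-- A residue `0 < z < p` (`p` prime) has an inverse `l` with `l·z mod p = 1`. [folklore] -/
theorem exists_inv_mod (p : ℕ) (hp : p.Prime) (z : ℕ) (hz : z < p) (hz0 : z ≠ 0) :
    ∃ l : ℕ, l * z % p = 1 := by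
  haveI := Fact.mk hp
  have hzp : (z : ZMod p) ≠ 0 := by
    intro h
    rw [ZMod.natCast_eq_zero_iff] at h
    exact hz0 (Nat.eq_zero_of_dvd_of_lt h hz)
  refine ⟨((z : ZMod p)⁻¹).val, ?_⟩
  have h1 : (((((z : ZMod p)⁻¹).val * z : ℕ)) : ZMod p) = ((1 : ℕ) : ZMod p) := by
    push_cast
    rw [ZMod.natCast_zmod_val, inv_mul_cancel₀ hzp]
  rw [ZMod.natCast_eq_natCast_iff'] at h1
  rw [h1, Nat.mod_eq_of_lt hp.one_lt]

/-- **Soundness of the normalised certificate** for every `(x, y, z) ∈ [0, p)³ ∖ 0`: scale the triple by the inverse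
of its last non-zero coordinate (`exists_scaled_rep`) and read the battery off `localCertOKNorm` at the normalised
triple. [cite: Marcus2018, Ch. 2, Thm. 13 and Exercise 27] -/
theorem localCertNorm_sound (hirr : Irreducible (MonicCubic.polyQ a b c))
    (hθ : aeval θ (MonicCubic.poly a b c) = 0) (h3 : finrank ℚ K = 3) (p : ℕ) (hp : p.Prime)
    (hc : localCertOKNorm a b c p = true) (x y z : ℕ) (hx : x < p) (hy : y < p) (hz : z < p)
    (hne : x ≠ 0 ∨ y ≠ 0 ∨ z ≠ 0) (w : 𝓞 K) :
    (p : K) * w ≠ (x : K) + (y : K) * θ + (z : K) * θ ^ 2 := by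
  intro hw
  simp only [localCertOKNorm, Bool.and_eq_true, List.all_eq_true, List.mem_range] at hc
  obtain ⟨⟨h100, hx10⟩, hxy1⟩ := hc
  have hp0 : 0 < p := hp.pos
  by_cases hz0 : z = 0
  · subst hz0
    by_cases hy0 : y = 0
    · subst hy0
      have hx0 : x ≠ 0 := by
        rcases hne with h | h | h
        · exact h
        · exact absurd rfl h
        · exact absurd rfl h
      -- normalise to `(1, 0, 0)`
      obtain ⟨l, hl⟩ := exists_inv_mod p hp x hx hx0
      obtain ⟨w', hw'⟩ := exists_scaled_rep hθ p x 0 0 w hw l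
      rw [hl, mul_zero, Nat.zero_mod] at hw'
      exact localTest_sound hirr hθ h3 p 1 0 0 h100 w' hw'
    · -- normalise to `(x', 1, 0)`
      obtain ⟨l, hl⟩ := exists_inv_mod p hp y hy hy0
      obtain ⟨w', hw'⟩ := exists_scaled_rep hθ p x y 0 w hw l
      rw [hl, mul_zero, Nat.zero_mod] at hw'
      exact localTest_sound hirr hθ h3 p _ 1 0 (hx10 _ (Nat.mod_lt _ hp0)) w' hw'
  · -- normalise to `(x', y', 1)`
    obtain ⟨l, hl⟩ := exists_inv_mod p hp z hz hz0
    obtain ⟨w', hw'⟩ := exists_scaled_rep hθ p x y z w hw l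
    rw [hl] at hw'
    exact localTest_sound hirr hθ h3 p _ _ 1 (hxy1 _ (Nat.mod_lt _ hp0) _ (Nat.mod_lt _ hp0)) w' hw'

/-- **`𝓞 K = ℤ[θ]` from a factorisation `|Δ(g)| = ∏ Pᵢ^{eᵢ}` and, for each `Pᵢ`, either `Pᵢ² ∤ Δ(g)` or the NORMALISED
Boolean local certificate at `Pᵢ`** (`p² + p + 1` triples instead of `p³ − 1`).
[cite: Marcus2018, Ch. 2, Thm. 13 and Exercise 27; Ch. 3, Thm. 27] -/
theorem exponent_thetaInt_of_localCertsNorm (hirr : Irreducible (MonicCubic.polyQ a b c))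
    (hθ : aeval θ (MonicCubic.poly a b c) = 0) (h3 : finrank ℚ K = 3) {k : ℕ} (P e : Fin k → ℕ)
    (hP : ∀ i, (P i).Prime) (hD : (MonicCubic.disc a b c).natAbs = ∏ i, P i ^ e i)
    (hcert : ∀ i, ¬ ((P i : ℤ) ^ 2 ∣ MonicCubic.disc a b c) ∨ localCertOKNorm a b c (P i) = true) :
    RingOfIntegers.exponent (MonicCubic.thetaInt hθ) = 1 := by
  refine exponent_thetaInt_of_local hirr hθ h3 fun p hp hp2 x y z hx hy hz hne w => ?_
  have hpd : p ∣ (MonicCubic.disc a b c).natAbs :=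
    Int.natCast_dvd.mp (dvd_trans (dvd_pow_self (p : ℤ) two_ne_zero) hp2)
  rw [hD] at hpd
  obtain ⟨i, hi⟩ := exists_eq_of_prime_dvd_prod_pow P e hP hp hpd
  subst hi
  rcases hcert i with hnd | hc
  · exact absurd hp2 hnd
  · exact localCertNorm_sound hirr hθ h3 (P i) (hP i) hc x y z hx hy hz hne w

end Summit.BirchSwinnertonDyer.BirchSwinnertonDyer.Rank2Observatory.TwoDescCl

end
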